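import Summits.Langlands.Langlands.Theorems.ParityBlindBianchiArtinWeightRealisationEvenStubTwistConjugateOfSignedTraces
import HarnessLib

/-!
# Stub `stub_adNormalFrame` (S4ad-frame) of the line `SketchIdeator2` for the crux
# `ParityBlindBianchi.ArtinWeightRealisationEven` (item stmt-Langlands-16619)

Pure algebra — the simultaneous dihedral normal frames under the ADJOINT trace identity.  Let `Γ`
be a group, `A` an algebraically closed field of characteristic `0`, `σ r : Γ → GL₂(A)` with finite
images, `σ` of projective image `A₅`, and `tr(r g)² · det σ(g) = tr(σ g)² · det r(g)` for all `g`
(i.e. `tr Ad⁰ r = tr Ad⁰ σ`).  Then there are frames `U`, `V`, a dihedral pair `g₅, s ∈ Γ` and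
scalars with `U σ(g₅) U⁻¹ = diag(l₁, l₂)`, `U σ(s) U⁻¹ = b W`, `V r(g₅) V⁻¹ = ε₁ diag(l₁, l₂)`,
`V r(s) V⁻¹ = ε₂ b W` (`l₁, l₂, b, ε₁, ε₂ ≠ 0`, `l₁ ≠ l₂`, `l₁² ≠ l₂²`).

PROOF (template: the landed S4b `stub_twistConjugateOfSignedTraces`).  (1) `exists_dihedral_pair`
gives `g₅, s`.  (2) Central-to-central (`AdNormalFrame.mem_center_of_adTrace`): if `σ(x) = c'·1`
then `tr σ(x)² = 4 det σ(x)`, so the identity gives `tr r(x)² = 4 det r(x)`; with `l = tr r(x)/2`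
Cayley–Hamilton gives `(r(x) - l)² = 0`, and `r(x)` has finite order, so `r(x) = l·1`
(`eq_smul_one_of_sq_eq_zero_of_pow_eq_one`); applied to `x = s g₅ s⁻¹ g₅` this yields the relation
`r(g₅) r(s) r(g₅) = c' r(s)`.  (3) `exists_eigenvalues` + `exists_normal_frame σ` give `l₁, l₂, U, b`.
(4) `l₁ + l₂ ≠ 0` (as `l₁² ≠ l₂²`); put `ε₁ := tr r(g₅) / (l₁ + l₂)`; the identity at `g₅` reads
`ε₁² (l₁ + l₂)² l₁ l₂ = (l₁ + l₂)² det r(g₅)`, so `det r(g₅) = (ε₁ l₁)(ε₁ l₂)` and `ε₁ ≠ 0`;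
`exists_normal_frame r` with eigenvalues `ε₁ l₁, ε₁ l₂` gives `V, b'`, and `ε₂ := b' / b`.
No definition, no named fact.
-/

-- the line's namespace `Summit.Langlands.Langlands.…` (summit = problem = `Langlands`) repeats a
-- component by design
set_option linter.dupNamespace false

namespace Summit.Langlands.Langlands.Theorems.ArtinWeightRealisationEven

open scoped MatrixGroups Matrix
open Literature.NumberTheory.EllipticCurves.DeuringLadic (Matrix.sq_eq_trace_smul_sub_det_fin_two)

universe u v

namespace AdNormalFrame

open TwistConjugate

variable {Γ : Type u} [Group Γ] {A : Type v} [Field A]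

/-- **Central-to-central under the adjoint trace identity.**  If `σ(x)` is scalar then
`tr σ(x)² = 4 det σ(x)`, so the identity gives `tr r(x)² = 4 det r(x)`: `r(x)` has a double
eigenvalue `l ≠ 0`, `(r(x) - l)² = 0` by Cayley–Hamilton, and being of finite order it is the
scalar `l`. -/
theorem mem_center_of_adTrace [CharZero A] (σ r : Γ →* GL (Fin 2) A) (hr : Finite r.range)
    (had : ∀ g : Γ, Matrix.trace ((r g : GL (Fin 2) A) : Matrix (Fin 2) (Fin 2) A) ^ 2 *
        Matrix.det ((σ g : GL (Fin 2) A) : Matrix (Fin 2) (Fin 2) A) =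
      Matrix.trace ((σ g : GL (Fin 2) A) : Matrix (Fin 2) (Fin 2) A) ^ 2 *
        Matrix.det ((r g : GL (Fin 2) A) : Matrix (Fin 2) (Fin 2) A))
    {x : Γ} (hx : σ x ∈ Subgroup.center (GL (Fin 2) A)) :
    r x ∈ Subgroup.center (GL (Fin 2) A) := by
  haveI := hr
  obtain ⟨c', hc'⟩ := exists_smul_one_of_mem_center hx
  have hc'0 : c' ≠ 0 := by
    rintro rfl
    have hu := ((Matrix.isUnit_iff_isUnit_det _).mp (σ x).isUnit).ne_zero
    rw [hc', zero_smul] at hu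
    simp at hu
  have hdR : Matrix.det ((r x : GL (Fin 2) A) : Matrix (Fin 2) (Fin 2) A) ≠ 0 :=
    ((Matrix.isUnit_iff_isUnit_det _).mp (r x).isUnit).ne_zero
  have h := had x
  rw [hc'] at h
  simp only [Matrix.det_smul, Matrix.det_one, Fintype.card_fin, mul_one, Matrix.trace_smul,
    Matrix.trace_one, Nat.cast_ofNat, smul_eq_mul] at h
  set R : Matrix (Fin 2) (Fin 2) A := ((r x : GL (Fin 2) A) : Matrix (Fin 2) (Fin 2) A) with hR
  -- `h : R.trace ^ 2 * c' ^ 2 = (c' * 2) ^ 2 * R.det`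
  have h4 : R.trace ^ 2 = 4 * R.det := by
    refine mul_right_cancel₀ (pow_ne_zero 2 hc'0) (h.trans ?_)
    ring
  obtain ⟨l, hl⟩ : ∃ l : A, l = R.trace / 2 := ⟨_, rfl⟩
  have htr : R.trace = 2 * l := by
    rw [hl, mul_div_cancel₀ _ (two_ne_zero' A)]
  have hdet : R.det = l * l := by
    have h' : (4 : A) * R.det = 4 * (l * l) := by rw [← h4, htr]; ring
    exact mul_left_cancel₀ (by norm_num : (4 : A) ≠ 0) h'
  have hl0 : l ≠ 0 := by
    rintro rfl
    rw [mul_zero] at hdet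
    exact hdR hdet
  have hsq : (R - l • 1) * (R - l • 1) = 0 := by
    have hCH := Matrix.sq_eq_trace_smul_sub_det_fin_two R
    rw [htr, hdet] at hCH
    have e1 : (R - l • 1) * (R - l • 1) = R * R - l • R - l • R + (l * l) • 1 := by
      simp only [sub_mul, mul_sub, Matrix.smul_mul, Matrix.mul_smul, smul_smul, Matrix.mul_one,
        Matrix.one_mul]
      abel
    rw [e1, hCH]
    module
  have hfo : IsOfFinOrder (r x) :=
    r.range.subtype.isOfFinOrder (isOfFinOrder_of_finite (⟨r x, x, rfl⟩ : r.range))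
  obtain ⟨m, hm, hxm⟩ := hfo.exists_pow_eq_one
  have hRm : R ^ m = 1 := by
    rw [hR, ← Units.val_pow_eq_pow_val, hxm, Units.val_one]
  exact mem_center_of_eq_smul_one (eq_smul_one_of_sq_eq_zero_of_pow_eq_one hl0 hsq hm hRm)

end AdNormalFrame

open TwistConjugate AdNormalFrame in
/-- S4ad-frame (the dihedral normal frames): for `σ r : Γ → GL₂(A)` with finite images, `σ`
projectively `A₅`, and the adjoint trace identity `tr(r g)² det σ(g) = tr(σ g)² det r(g)`, there
are frames `U`, `V` and a dihedral pair `g₅, s` with `U σ U⁻¹(g₅) = diag(l₁, l₂)`,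
`U σ U⁻¹(s) = b W`, `V r V⁻¹(g₅) = ε₁ diag(l₁, l₂)`, `V r V⁻¹(s) = ε₂ b W`. -/
theorem stub_adNormalFrame :
    ∀ (Γ : Type u) [Group Γ] (A : Type v) [Field A] [IsAlgClosed A] [CharZero A] (σ r : Γ →* GL (Fin 2) A), Finite σ.range → Finite r.range → Nonempty ((Matrix.ProjGenLinGroup.mk.comp σ).range ≃* alternatingGroup (Fin 5)) → (∀ g : Γ, Matrix.trace ((r g : GL (Fin 2) A) : Matrix (Fin 2) (Fin 2) A) ^ 2 * Matrix.det ((σ g : GL (Fin 2) A) : Matrix (Fin 2) (Fin 2) A) = Matrix.trace ((σ g : GL (Fin 2) A) : Matrix (Fin 2) (Fin 2) A) ^ 2 * Matrix.det ((r g : GL (Fin 2) A) : Matrix (Fin 2) (Fin 2) A)) → ∃ (U V : GL (Fin 2) A) (g₅ s : Γ) (l₁ l₂ b ε₁ ε₂ : A), l₁ ≠ 0 ∧ l₂ ≠ 0 ∧ l₁ ≠ l₂ ∧ l₁ ^ 2 ≠ l₂ ^ 2 ∧ b ≠ 0 ∧ ε₁ ≠ 0 ∧ ε₂ ≠ 0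 ∧ ((U * σ g₅ * U⁻¹ : GL (Fin 2) A) : Matrix (Fin 2) (Fin 2) A) = !![l₁, 0; 0, l₂] ∧ ((U * σ s * U⁻¹ : GL (Fin 2) A) : Matrix (Fin 2) (Fin 2) A) = !![0, b; b, 0] ∧ ((V * r g₅ * V⁻¹ : GL (Fin 2) A) : Matrix (Fin 2) (Fin 2) A) = ε₁ • !![l₁, 0; 0, l₂] ∧ ((V * r s * V⁻¹ : GL (Fin 2) A) : Matrix (Fin 2) (Fin 2) A) = ε₂ • !![0, b; b, 0] := by
  intro Γ _ A _ _ _ σ r hσ hr hA5 had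
  haveI := hσ
  obtain ⟨e⟩ := hA5
  /- (1) the dihedral pair -/
  obtain ⟨g₅, s, hcen5, hncen, hcenrel⟩ := exists_dihedral_pair σ e
  have hcenrelr : r (s * g₅ * s⁻¹ * g₅) ∈ Subgroup.center (GL (Fin 2) A) :=
    mem_center_of_adTrace σ r hr had hcenrel
  /- (2) scalars and relations -/
  obtain ⟨c₅, hc₅⟩ := exists_smul_one_of_mem_center hcen5
  obtain ⟨cr, hcr⟩ := exists_smul_one_of_mem_center hcenrel
  obtain ⟨cr', hcr'⟩ := exists_smul_one_of_mem_center hcenrelr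
  have hS55 : ((σ g₅ : GL (Fin 2) A) : Matrix (Fin 2) (Fin 2) A) ^ 5 = c₅ • 1 := by
    rw [← Units.val_pow_eq_pow_val, ← map_pow, hc₅]
  have hrelS : ((σ g₅ : GL (Fin 2) A) : Matrix (Fin 2) (Fin 2) A) * (σ s : GL (Fin 2) A) *
      (σ g₅ : GL (Fin 2) A) = cr • ((σ s : GL (Fin 2) A) : Matrix (Fin 2) (Fin 2) A) := by
    have h := mul_mul_eq_of_rel hcenrel (a := σ s) (b := σ g₅)
      (by rw [map_mul, map_mul, map_mul, map_inv])
    have h2 := congrArg (fun x : GL (Fin 2) A => (x : Matrix (Fin 2) (Fin 2) A)) h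
    simp only [Units.val_mul, hcr, Matrix.smul_mul, Matrix.one_mul] at h2
    exact h2
  have hrelR : ((r g₅ : GL (Fin 2) A) : Matrix (Fin 2) (Fin 2) A) * (r s : GL (Fin 2) A) *
      (r g₅ : GL (Fin 2) A) = cr' • ((r s : GL (Fin 2) A) : Matrix (Fin 2) (Fin 2) A) := by
    have h := mul_mul_eq_of_rel hcenrelr (a := r s) (b := r g₅)
      (by rw [map_mul, map_mul, map_mul, map_inv])
    have h2 := congrArg (fun x : GL (Fin 2) A => (x : Matrix (Fin 2) (Fin 2) A)) h
    simp only [Units.val_mul, hcr', Matrix.smul_mul, Matrix.one_mul] at h2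
    exact h2
  /- (3) finite order and eigenvalues of `σ g₅`, the normal frame for `σ` -/
  have hfo : IsOfFinOrder (σ g₅) :=
    σ.range.subtype.isOfFinOrder (isOfFinOrder_of_finite (⟨σ g₅, g₅, rfl⟩ : σ.range))
  obtain ⟨m, hm, hgm⟩ := hfo.exists_pow_eq_one
  have hS5m : ((σ g₅ : GL (Fin 2) A) : Matrix (Fin 2) (Fin 2) A) ^ m = 1 := by
    rw [← Units.val_pow_eq_pow_val, hgm, Units.val_one]
  have hSns : ∀ cc : A, ((σ g₅ : GL (Fin 2) A) : Matrix (Fin 2) (Fin 2) A) ≠ cc • 1 :=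
    fun cc hcc => hncen (mem_center_of_eq_smul_one hcc)
  obtain ⟨l₁, l₂, htr, hdet, h1, h2, hne, hsq⟩ := exists_eigenvalues hm hS5m hSns hS55
  obtain ⟨U, b, hb, hUS5, hUSs⟩ := exists_normal_frame σ h1 h2 hne hsq htr hdet hrelS
  /- (4) the eigenvalues `ε₁ l₁, ε₁ l₂` of `r g₅` from the identity at `g₅`, the frame for `r` -/
  have hsum : l₁ + l₂ ≠ 0 := fun h0 => hsq (by linear_combination (l₁ - l₂) * h0)
  obtain ⟨ε₁, hε₁⟩ : ∃ ε : A,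
      ε = Matrix.trace ((r g₅ : GL (Fin 2) A) : Matrix (Fin 2) (Fin 2) A) / (l₁ + l₂) :=
    ⟨_, rfl⟩
  have htrR : ((r g₅ : GL (Fin 2) A) : Matrix (Fin 2) (Fin 2) A).trace = ε₁ * l₁ + ε₁ * l₂ := by
    rw [hε₁, ← mul_add, div_mul_cancel₀ _ hsum]
  have hdetR : ((r g₅ : GL (Fin 2) A) : Matrix (Fin 2) (Fin 2) A).det = ε₁ * l₁ * (ε₁ * l₂) := by
    have h := had g₅
    rw [htrR, htr, hdet] at h
    have h' : (l₁ + l₂) ^ 2 * ((r g₅ : GL (Fin 2) A) : Matrix (Fin 2) (Fin 2) A).det =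
        (l₁ + l₂) ^ 2 * (ε₁ * l₁ * (ε₁ * l₂)) := by
      linear_combination -h
    exact mul_left_cancel₀ (pow_ne_zero 2 hsum) h'
  have hε0 : ε₁ ≠ 0 := by
    intro h0
    apply ((Matrix.isUnit_iff_isUnit_det _).mp (r g₅).isUnit).ne_zero
    rw [hdetR, h0]
    ring
  have hneR : ε₁ * l₁ ≠ ε₁ * l₂ := fun h => hne (mul_left_cancel₀ hε0 h)
  have h1R : ε₁ * l₁ ≠ 0 := mul_ne_zero hε0 h1
  have h2R : ε₁ * l₂ ≠ 0 := mul_ne_zero hε0 h2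
  have hsqR : (ε₁ * l₁) ^ 2 ≠ (ε₁ * l₂) ^ 2 := by
    rw [mul_pow, mul_pow]
    exact fun h => hsq (mul_left_cancel₀ (pow_ne_zero 2 hε0) h)
  obtain ⟨V, b', hb', hVR5, hVRs⟩ := exists_normal_frame r h1R h2R hneR hsqR htrR hdetR hrelR
  /- (5) output -/
  refine ⟨U, V, g₅, s, l₁, l₂, b, ε₁, b' / b, h1, h2, hne, hsq, hb, hε0, div_ne_zero hb' hb, hUS5,
    hUSs, ?_, ?_⟩
  · rw [hVR5]
    ext i j
    fin_cases i <;> fin_cases j <;> simp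
  · rw [hVRs]
    ext i j
    fin_cases i <;> fin_cases j <;> simp [hb]

end Summit.Langlands.Langlands.Theorems.ArtinWeightRealisationEven
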